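import Mathlib
import Summits.ValiantsHypothesis.ValiantsHypothesis.Theorems.GeneratorObstructionsPowGenDegreeQPDoublingGadgetWindow

/-!
# Route GeneratorObstructions — crux K2 `PowGenDegreeQP` (stmt-ValiantsHypothesis-11655), line
# `trace-side-regimes`: the doubling gadget kills the SLICE stub too (modulo the GIT input)

Companion of `…PowGenDegreeQPDoublingGadgetWindow`.  The gadget lives on `3c ≤ (5k)²` of the own
`m² = (5k)²` letters, so it lies in the SLICE regime of `stub_sliceGen` (the half of K2 the route's
glue consumes, and the recommended restatement `K2 := stub_sliceGen`).  Here: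

* `exists_canonicalPlacement` — for `3c ≤ 25k²` the canonical placement
  `B 0 < A 0 < B 1 < A' 0 < A 1 < B 2 < A' 1 < … < A (c-1) < A' (c-1)` on the final `3c` letters of
  `MatIdx (5k)` exists (injective, disjoint, interleaved), packaged once;
* `sliceGen_gadget_bound` — the registered `stub_sliceGen` (hypothesis verbatim) bounds the gadget
  cell by cell exactly as K2 does (`genQP_of_sliceGen_of_hasPowTraceRepr`);
* `not_sliceGen_of_canonicalGadgetGIT` — **the Kempf–Hilbert–Mumford input for the canonical gadget
  refutes `stub_sliceGen`** (same parameters `t = 2(c₀+2)²`, `k = 2^t`, `c = 4^t`).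

Honest framing: conditional refutation by name; the GIT input (one nonconstant semi-invariant
nonzero at the canonical gadget; `-χ** ∈ cone(supp g)`, Kempf 1978) is NOT proved in the tree; no
stub, crux or summit is settled; `VP ≠ VNP` untouched.
-/

namespace Summit.ValiantsHypothesis.ValiantsHypothesis.Theorems.GeneratorObstructions.PowGenDegreeQP

open MvPolynomial
open Literature.NumberTheory.DiophantineGeometry Literature.Computability.AlgebraicComplexity
  Literature.Barriers.ValiantsHypothesis
open Summit.ValiantsHypothesis.ValiantsHypothesis.Theses.GeneratorObstructions
open Summit.ValiantsHypothesis.ValiantsHypothesis.Theorems.GenInheritance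
open Summit.ValiantsHypothesis.ValiantsHypothesis.Theorems.GeneratorObstructions.SliceTransfer

-- `Summit.ValiantsHypothesis.ValiantsHypothesis.…` is the tree's mandated single-conjunct layout.
set_option linter.dupNamespace false

noncomputable section

/-- **The canonical placement exists** whenever `3c ≤ 25k²`, `c ≥ 1`: a strictly monotone
`ι : Fin (3c) → MatIdx (5k)` onto a final segment, whose canonical letters
`B j = ι(B-pos j)`, `A j = ι(3j+1)`, `A' j = ι(A'-pos j)` are injective, pairwise disjoint and
interleaved `A j < B (j+1) < A' j`. [folklore] -/
theorem exists_canonicalPlacement {k c : ℕ} (hc : 0 < c) (hfit : 3 * c ≤ 5 * k * (5 * k)) :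
    ∃ ι : Fin (3 * c) → MatIdx (5 * k), StrictMono ι ∧ IsUpperSet (Set.range ι) ∧
      Function.Injective (fun j : Fin c => ι ⟨if j.val = 0 then 0 else 3 * j.val - 1, canonPosB_lt j⟩) ∧
      Function.Injective (fun j : Fin c => ι ⟨3 * j.val + 1, canonPosA_lt j⟩) ∧
      Function.Injective (fun j : Fin c =>
        ι ⟨if j.val = c - 1 then 3 * c - 1 else 3 * j.val + 3, canonPosA'_lt j⟩) ∧
      (∀ i j : Fin c, ι ⟨if i.val = 0 then 0 else 3 * i.val - 1, canonPosB_lt i⟩ ≠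
        ι ⟨3 * j.val + 1, canonPosA_lt j⟩) ∧
      (∀ i j : Fin c, ι ⟨if i.val = 0 then 0 else 3 * i.val - 1, canonPosB_lt i⟩ ≠
        ι ⟨if j.val = c - 1 then 3 * c - 1 else 3 * j.val + 3, canonPosA'_lt j⟩) ∧
      (∀ i j : Fin c, ι ⟨3 * i.val + 1, canonPosA_lt i⟩ ≠
        ι ⟨if j.val = c - 1 then 3 * c - 1 else 3 * j.val + 3, canonPosA'_lt j⟩) ∧
      (∀ (j : Fin c) (h : j.val + 1 < c), ι ⟨3 * j.val + 1, canonPosA_lt j⟩ <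
        ι ⟨if (⟨j.val + 1, h⟩ : Fin c).val = 0 then 0 else 3 * (⟨j.val + 1, h⟩ : Fin c).val - 1,
          canonPosB_lt (⟨j.val + 1, h⟩ : Fin c)⟩) ∧
      (∀ (j : Fin c) (h : j.val + 1 < c),
        ι ⟨if (⟨j.val + 1, h⟩ : Fin c).val = 0 then 0 else 3 * (⟨j.val + 1, h⟩ : Fin c).val - 1,
          canonPosB_lt (⟨j.val + 1, h⟩ : Fin c)⟩ <
        ι ⟨if j.val = c - 1 then 3 * c - 1 else 3 * j.val + 3, canonPosA'_lt j⟩) := by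
  have hcard : Fintype.card (Fin (3 * c)) ≤ Fintype.card (MatIdx (5 * k)) := by
    rw [Fintype.card_fin, Fintype.card_lex, Fintype.card_prod, Fintype.card_fin]
    exact hfit
  obtain ⟨ι, hι, hup⟩ := exists_strictMono_isUpperSet (σ := Fin (3 * c)) (τ := MatIdx (5 * k)) hcard
  have hιinj := hι.injective
  refine ⟨ι, hι, hup, ?_, ?_, ?_, ?_, ?_, ?_, ?_, ?_⟩
  · intro i j h
    have h' := Fin.mk.inj_iff.mp (hιinj h)
    apply Fin.ext
    split_ifs at h'
    all_goals omega
  · intro i j h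
    have h' := Fin.mk.inj_iff.mp (hιinj h)
    exact Fin.ext (by omega)
  · intro i j h
    have h' := Fin.mk.inj_iff.mp (hιinj h)
    apply Fin.ext
    split_ifs at h'
    all_goals omega
  · intro i j h
    have h' := Fin.mk.inj_iff.mp (hιinj h)
    split_ifs at h'
    all_goals omega
  · intro i j h
    have h' := Fin.mk.inj_iff.mp (hιinj h)
    split_ifs at h'
    all_goals omega
  · intro i j h
    have h' := Fin.mk.inj_iff.mp (hιinj h)
    split_ifs at h'
    all_goals omega
  · intro j h
    apply hι
    rw [Fin.mk_lt_mk]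
    simp; omega
  · intro j h
    apply hι
    rw [Fin.mk_lt_mk]
    dsimp only
    split_ifs
    all_goals omega

/-- **`stub_sliceGen` bounds the doubling gadget, cell by cell** (hypothesis = the registered stub
verbatim): for every window exponent `c_w` some `c₀` with — in every gadget cell of the window and
for every placement — [one nonconstant semi-invariant nonzero at `g`] ⟹ `2^c ≤ 5k · 2^((log₂ 5k + c₀)^c₀)`.
Via the landed `genQP_of_sliceGen_of_hasPowTraceRepr`. [cite: GesmundoIkenmeyerPanova2017, Prop. 5] -/
theorem sliceGen_gadget_bound
    (hS : ∀ c : ℕ, ∃ c₀ : ℕ, ∀ m e : ℕ, 1 ≤ m → m + e ≤ 2 ^ ((Nat.log 2 m + c) ^ c) →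
      ∀ ι : MatIdx m → MatIdx (m + e), StrictMono ι → IsUpperSet (Set.range ι) →
        ∀ χ : Weight (MatIdx m),
          Module.finrank ℂ (↥(highestWeightSpace (orbitCoordRep (powFormLex ℂ (m + e) m) m) (Function.extend ι χ 0)) ⧸ Submodule.comap (highestWeightSpace (orbitCoordRep (powFormLex ℂ (m + e) m) m) (Function.extend ι χ 0)).subtype (⨆ p : Weight (MatIdx (m + e)) × Weight (MatIdx (m + e)), ⨆ (_ : p.1 + p.2 = (Function.extend ι χ 0) ∧ p.1 ≠ 0 ∧ p.2 ≠ 0), highestWeightSpace (orbitCoordRep (powFormLex ℂ (m + e) m) m) p.1 * highestWeightSpace (orbitCoordRep (powFormLex ℂ (m + e) m) m) p.2)) ≠ 0 →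
            -(Weight.size χ) ≤ (m : ℤ) * 2 ^ ((Nat.log 2 m + c₀) ^ c₀)) :
    ∀ c_w : ℕ, ∃ c₀ : ℕ, ∀ (k c e : ℕ), 1 ≤ k → 0 < c →
      5 * k + e ≤ 2 ^ ((Nat.log 2 (5 * k) + c_w) ^ c_w) → c * (5 * k) ≤ 5 * k + e →
      ∀ (B A A' : Fin c → MatIdx (5 * k)),
        Function.Injective B → Function.Injective A → Function.Injective A' →
        (∀ i j, B i ≠ A j) → (∀ i j, B i ≠ A' j) → (∀ i j, A i ≠ A' j) →
        (∀ (j : Fin c) (h : j.val + 1 < c), A j < B ⟨j.val + 1, h⟩) →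
        (∀ (j : Fin c) (h : j.val + 1 < c), B ⟨j.val + 1, h⟩ < A' j) →
        (∃ χ₀ : Weight (MatIdx (5 * k)), (∃ i j, χ₀ i ≠ χ₀ j) ∧
          ∃ x ∈ highestWeightSpace (orbitCoordRep
            (∑ j : Fin c, (X (B j) ^ k * (X (A j) ^ (2 * k) * X (A' j) ^ (2 * k)) :
              MvPolynomial (MatIdx (5 * k)) ℂ)) (5 * k)) χ₀,
            evalAtPoint (∑ j : Fin c, (X (B j) ^ k * (X (A j) ^ (2 * k) * X (A' j) ^ (2 * k)) :
              MvPolynomial (MatIdx (5 * k)) ℂ)) (5 * k) x ≠ 0) →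
        (2 : ℤ) ^ c ≤ ((5 * k : ℕ) : ℤ) * 2 ^ ((Nat.log 2 (5 * k) + c₀) ^ c₀) := by
  intro c_w
  obtain ⟨c₀, hc₀⟩ := genQP_of_sliceGen_of_hasPowTraceRepr hS c_w
  refine ⟨c₀, fun k c e hk hc hwin hce B A A' hBi hAi hA'i hBA hBA' hAA' hord1 hord2 hGIT => ?_⟩
  set g : MvPolynomial (MatIdx (5 * k)) ℂ :=
    ∑ j : Fin c, (X (B j) ^ k * (X (A j) ^ (2 * k) * X (A' j) ^ (2 * k))) with hg
  have hrep : HasPowTraceRepr ℂ g (5 * k) (5 * k + e) :=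
    HasPowTraceRepr.of_le (by omega) hce (hasPowTraceRepr_gadget hk B A A')
  obtain ⟨χ, -, hle, hγ⟩ := gadget_late_genType_of_eval_ne_zero B A A' hc hBi hAi hA'i hBA hBA' hAA'
    hord1 hord2 g (m := 5 * k) (by omega) hg hGIT
  have hb := hc₀ (5 * k) e (by omega) hwin g (gadget_isHomogeneous k B A A') (gadget_ne_zero hc k B A A')
    hrep χ hγ
  exact hle.trans hb

/-- **`stub_sliceGen` is refuted by the Kempf–Hilbert–Mumford input for the CANONICAL doubling
gadget** (same hypothesis as `not_powGenDegreeQP_of_canonicalGadgetGIT`): the registered slice stub —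
the half of K2 the route's glue consumes and the recommended restatement of K2 — fails as soon as one
highest-weight vector of nonconstant weight is nonzero at the canonically placed sparse form
`g = Σ_j x_{B j}^k x_{A j}^{2k} x_{A' j}^{2k}` for all `k, c ≥ 1` (`-χ** ∈ cone(supp g)`, Kempf 1978 —
not proved here). [cite: GesmundoIkenmeyerPanova2017, Prop. 5] -/
theorem not_sliceGen_of_canonicalGadgetGIT
    (hGIT : ∀ (k c : ℕ) (hk : 1 ≤ k) (hc : 0 < c) (ι : Fin (3 * c) → MatIdx (5 * k)),
      StrictMono ι → IsUpperSet (Set.range ι) →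
      ∃ χ₀ : Weight (MatIdx (5 * k)), (∃ i j, χ₀ i ≠ χ₀ j) ∧
        ∃ x ∈ highestWeightSpace (orbitCoordRep
          (∑ j : Fin c,
            (X (ι ⟨if j.val = 0 then 0 else 3 * j.val - 1, canonPosB_lt j⟩) ^ k *
              (X (ι ⟨3 * j.val + 1, canonPosA_lt j⟩) ^ (2 * k) *
                X (ι ⟨if j.val = c - 1 then 3 * c - 1 else 3 * j.val + 3, canonPosA'_lt j⟩) ^ (2 * k)) :
            MvPolynomial (MatIdx (5 * k)) ℂ)) (5 * k)) χ₀,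
          evalAtPoint (∑ j : Fin c,
            (X (ι ⟨if j.val = 0 then 0 else 3 * j.val - 1, canonPosB_lt j⟩) ^ k *
              (X (ι ⟨3 * j.val + 1, canonPosA_lt j⟩) ^ (2 * k) *
                X (ι ⟨if j.val = c - 1 then 3 * c - 1 else 3 * j.val + 3, canonPosA'_lt j⟩) ^ (2 * k)) :
            MvPolynomial (MatIdx (5 * k)) ℂ)) (5 * k) x ≠ 0) :
    ¬ (∀ c : ℕ, ∃ c₀ : ℕ, ∀ m e : ℕ, 1 ≤ m → m + e ≤ 2 ^ ((Nat.log 2 m + c) ^ c) →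
      ∀ ι : MatIdx m → MatIdx (m + e), StrictMono ι → IsUpperSet (Set.range ι) →
        ∀ χ : Weight (MatIdx m),
          Module.finrank ℂ (↥(highestWeightSpace (orbitCoordRep (powFormLex ℂ (m + e) m) m) (Function.extend ι χ 0)) ⧸ Submodule.comap (highestWeightSpace (orbitCoordRep (powFormLex ℂ (m + e) m) m) (Function.extend ι χ 0)).subtype (⨆ p : Weight (MatIdx (m + e)) × Weight (MatIdx (m + e)), ⨆ (_ : p.1 + p.2 = (Function.extend ι χ 0) ∧ p.1 ≠ 0 ∧ p.2 ≠ 0), highestWeightSpace (orbitCoordRep (powFormLex ℂ (m + e) m) m) p.1 * highestWeightSpace (orbitCoordRep (powFormLex ℂ (m + e) m) m) p.2)) ≠ 0 →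
            -(Weight.size χ) ≤ (m : ℤ) * 2 ^ ((Nat.log 2 m + c₀) ^ c₀)) := by
  intro hS
  obtain ⟨c₀, hc₀⟩ := sliceGen_gadget_bound hS 2
  obtain ⟨ht, hfit, hwin, hlate⟩ := gadget_parameters_at c₀ (2 * (c₀ + 2) ^ 2) rfl
  set t : ℕ := 2 * (c₀ + 2) ^ 2 with htdef
  set k : ℕ := 2 ^ t with hk
  set c : ℕ := 4 ^ t with hc
  have hk1 : 1 ≤ k := Nat.one_le_two_pow
  have hc1 : 0 < c := by positivity
  obtain ⟨ι, hι, hup, hBi, hAi, hA'i, hBA, hBA', hAA', hord1, hord2⟩ :=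
    exists_canonicalPlacement (k := k) (c := c) hc1 hfit
  have hP : 5 * k ≤ c * (5 * k) := Nat.le_mul_of_pos_left _ hc1
  have hsum : 5 * k + (c * (5 * k) - 5 * k) = 5 * 2 ^ t * 4 ^ t := by
    have h1 : 5 * k + (c * (5 * k) - 5 * k) = c * (5 * k) := by omega
    rw [h1, hk, hc]; ring
  have hb := hc₀ k c (c * (5 * k) - 5 * k) hk1 hc1 (by rw [hsum]; exact hwin) (by omega)
    (fun j : Fin c => ι ⟨if j.val = 0 then 0 else 3 * j.val - 1, canonPosB_lt j⟩)
    (fun j : Fin c => ι ⟨3 * j.val + 1, canonPosA_lt j⟩)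
    (fun j : Fin c => ι ⟨if j.val = c - 1 then 3 * c - 1 else 3 * j.val + 3, canonPosA'_lt j⟩)
    hBi hAi hA'i hBA hBA' hAA' hord1 hord2 (hGIT k c hk1 hc1 ι hι hup)
  have hlate' : ((5 * k : ℕ) : ℤ) * 2 ^ ((Nat.log 2 (5 * k) + c₀) ^ c₀) < (2 : ℤ) ^ c := by
    rw [hk, hc]; exact_mod_cast hlate
  exact absurd (hb.trans_lt hlate') (lt_irrefl _)

end

end Summit.ValiantsHypothesis.ValiantsHypothesis.Theorems.GeneratorObstructions.PowGenDegreeQP
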